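import Literature.AlgebraicGeometry.Frobenioids.PadicKummerDualityIsoConjugation
import HarnessLib

/-!
# Frobenioids II, Def. 2.2 (ii) / Thm. 2.4 (i): the cup-product duality isomorphism EXISTS for a
# context iff it exists for an isomorphic one (transport of the two bijectivity inputs)

Mochizuki, *The geometry of Frobenioids II*, Kyushu J. Math. **62** (2008) 401–460, §2, Definition 2.2
(ii) p. 18 and Theorem 2.4 (i) pp. 19–20 [cite: MochizukiFrdII2008, Thm 2.4 (i) p.19]: `Ψ` "induces
isomorphisms … `H¹((H₁)_{A₁}, μ_N(A₁)) ⥲ H¹((H₂)_{A₂}, μ_N(A₂))`; `F_N(A₁) ⥲ F_N(A₂)`" compatible with the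
duality isomorphisms `H¹(H_A, μ_N(A)) ⥲ H_A^ab ⊗ F_N(A)`.

Proof-side companion (abc-iut-L2-t12, γ₁ lane). The cup-product duality isomorphism of a Definition 2.2
context (`Def22Context.dualityIsoOfBijective X N hθ hcup`) is built from TWO bijectivity inputs: `θ`
(`thetaHomOf X N`) and the adjoint cup product (`cupDualOf X N`). Along ANY isomorphism of contexts
`e : X₁.Iso X₂` both inputs TRANSPORT:
* `Iso.abEquiv` — `H_{A₁}^ab ≃+ H_{A₂}^ab` (Mathlib `MulEquiv.abelianizationCongr`, = abc-iut-L2-t12's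
  `Iso.abHom` on elements), whence `Iso.dualTransportEquiv` — the transport
  `Hom(Hom(H_{A₁}^ab, ℤ/N), F_N(A₁)) ≃+ Hom(Hom(H_{A₂}^ab, ℤ/N), F_N(A₂))` of `KummerDualityNaturality.lean`
  (`Iso.dualTransport`) as an EQUIVALENCE;
* `Iso.cupDualOf_bijective_iff` — from the naturality `cupDual_push` (`cupDual₂ ∘ push = dualTransport ∘
  cupDual₁`, `push` bijective);
* `Iso.thetaHomOf_bijective_iff` — from the naturality `thetaHom_recTargetMap` (`θ₂ ∘ (isoHA^ab ⊗ isoFN) =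
  dualTransport ∘ θ₁`, `isoHA^ab ⊗ isoFN` bijective: it is `TensorProduct.congr`).
Consequences: the duality isomorphism exists for `X₂` as soon as it exists for an isomorphic `X₁`
(`Iso.dualityIsoOfBijective'`) — e.g. for EVERY context isomorphic to an arithmetic context
`ofLocalField L H hH S` of an `(N, H)`-saturated object (`dualityIsoOfIsoLocalField`, NO residual
input) — and the "independence of the choice of `H ↠ H_A`" clause of Def. 2.2 (ii) p. 18 holds at the
binding with NO residual input (`recTargetMap_dualityIsoOfLocalField_toConjOuter'`, discharging the two
explicit inputs of `PadicKummerDualityIsoConjugation.lean`). Nothing here concerns [IUTchIII]; classical.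
-/

noncomputable section

namespace Literature.AlgebraicGeometry.Frobenioids

namespace PadicKummer

namespace Def22Context

open Kummer
open scoped TensorProduct

namespace Iso

variable {X₁ X₂ : Def22Context} (e : Def22Context.Iso X₁ X₂) (N : ℕ)

/-! ### `H_{A₁}^ab ≃ H_{A₂}^ab` and the transport of `Hom(Hom(H_A^ab, ℤ/N), F_N)` as equivalences -/

/-- `H_{A₁}^ab ≃+ H_{A₂}^ab` induced by `(H₁)_{A₁} ⥲ (H₂)_{A₂}` (Mathlib's `abelianizationCongr`,
additively); on elements it is `Iso.abHom`. [cite: MochizukiFrdII2008, Thm 2.4 (i) p.19] -/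
def abEquiv : Additive (Abelianization X₁.HA) ≃+ Additive (Abelianization X₂.HA) :=
  MulEquiv.toAdditive (MulEquiv.abelianizationCongr e.isoHA)

/-- `abEquiv = abHom` on elements. [cite: MochizukiFrdII2008, Thm 2.4 (i) p.19] -/
@[simp] theorem abEquiv_apply (x : Additive (Abelianization X₁.HA)) : e.abEquiv x = e.abHom x := rfl

/-- `abHom` is bijective. [cite: MochizukiFrdII2008, Thm 2.4 (i) p.19] -/
theorem abHom_bijective : Function.Bijective e.abHom := e.abEquiv.bijective

/-- Precomposition of a character `χ₁ : H_{A₁}^ab → ℤ/N` with `abEquiv⁻¹`, then with `abHom`, gives back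
`χ₁`. [cite: MochizukiFrdII2008, Thm 2.4 (i) p.19] -/
theorem comp_abEquiv_symm_comp_abHom (χ₁ : Additive (Abelianization X₁.HA) →+ ZMod N) :
    (χ₁.comp e.abEquiv.symm.toAddMonoidHom).comp e.abHom = χ₁ := by
  refine AddMonoidHom.ext fun x => ?_
  change χ₁ (e.abEquiv.symm (e.abEquiv x)) = χ₁ x
  rw [AddEquiv.symm_apply_apply]

/-- Precomposition of `χ₂ : H_{A₂}^ab → ℤ/N` with `abHom`, then with `abEquiv⁻¹`, gives back `χ₂`.
[cite: MochizukiFrdII2008, Thm 2.4 (i) p.19] -/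
theorem comp_abHom_comp_abEquiv_symm (χ₂ : Additive (Abelianization X₂.HA) →+ ZMod N) :
    (χ₂.comp e.abHom).comp e.abEquiv.symm.toAddMonoidHom = χ₂ := by
  refine AddMonoidHom.ext fun y => ?_
  change χ₂ (e.abEquiv (e.abEquiv.symm y)) = χ₂ y
  rw [AddEquiv.apply_symm_apply]

/-- **The transport `Hom(Hom(H_{A₁}^ab, ℤ/N), F_N(A₁)) ≃+ Hom(Hom(H_{A₂}^ab, ℤ/N), F_N(A₂))` as an
equivalence** (`Iso.dualTransport` with its inverse `ψ′ ↦ (χ₁ ↦ isoFN⁻¹ (ψ′ (χ₁ ∘ abEquiv⁻¹)))`).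
[cite: MochizukiFrdII2008, Thm 2.4 (i) p.19] -/
def dualTransportEquiv : ((Additive (Abelianization X₁.HA) →+ ZMod N) →+ FN X₁ N) ≃+
    ((Additive (Abelianization X₂.HA) →+ ZMod N) →+ FN X₂ N) :=
  { e.dualTransport N with
    invFun := fun ψ' =>
      { toFun := fun χ₁ => (e.isoFN N).symm (ψ' (χ₁.comp e.abEquiv.symm.toAddMonoidHom))
        map_zero' := by rw [AddMonoidHom.zero_comp, map_zero, map_zero]
        map_add' := fun χ χ' => by rw [AddMonoidHom.add_comp, map_add, map_add] }
    left_inv := fun ψ => by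
      refine AddMonoidHom.ext fun χ₁ => ?_
      change (e.isoFN N).symm (e.dualTransport N ψ (χ₁.comp e.abEquiv.symm.toAddMonoidHom)) = ψ χ₁
      rw [dualTransport_apply, AddEquiv.symm_apply_apply, comp_abEquiv_symm_comp_abHom]
    right_inv := fun ψ' => by
      refine AddMonoidHom.ext fun χ₂ => ?_
      change e.isoFN N ((e.isoFN N).symm (ψ' ((χ₂.comp e.abHom).comp e.abEquiv.symm.toAddMonoidHom))) =
        ψ' χ₂
      rw [AddEquiv.apply_symm_apply, comp_abHom_comp_abEquiv_symm] }

/-- `dualTransportEquiv = dualTransport` on elements. [cite: MochizukiFrdII2008, Thm 2.4 (i) p.19] -/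
@[simp] theorem dualTransportEquiv_apply (ψ : (Additive (Abelianization X₁.HA) →+ ZMod N) →+ FN X₁ N) :
    e.dualTransportEquiv N ψ = e.dualTransport N ψ := rfl

/-- `dualTransport` is bijective. [cite: MochizukiFrdII2008, Thm 2.4 (i) p.19] -/
theorem dualTransport_bijective : Function.Bijective (e.dualTransport N) :=
  (e.dualTransportEquiv N).bijective

/-! ### Transport of the bijectivity of the adjoint cup product -/

/-- `push : H¹((H₁)_{A₁}, μ_N(A₁)) → H¹((H₂)_{A₂}, μ_N(A₂))` (continuous cohomology) is bijective.
[cite: MochizukiFrdII2008, Thm 2.4 (i) p.19] -/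
theorem push_transportMu_bijective : Function.Bijective ((e.transportMu N).push 1).hom :=
  Function.bijective_iff_has_inverse.mpr
    ⟨((e.transportMu N).pull 1).hom, fun x => (e.transportMu N).pull_push_apply 1 x,
      fun x => (e.transportMu N).push_pull_apply 1 x⟩

/-- `cupDual₂ ∘ push = dualTransport ∘ cupDual₁` as functions (`cupDual_push`).
[cite: MochizukiFrdII2008, Thm 2.4 (i) p.19] -/
theorem cupDualOf_comp_push :
    (cupDualOf X₂ N) ∘ ((e.transportMu N).push 1).hom = (e.dualTransport N) ∘ (cupDualOf X₁ N) :=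
  funext fun x => e.cupDual_push N x

include e in
/-- **The adjoint cup product of `X₂` is bijective iff that of `X₁` is**, along any context
isomorphism. [cite: MochizukiFrdII2008, Thm 2.4 (i) p.19] -/
theorem cupDualOf_bijective_iff :
    Function.Bijective (cupDualOf X₁ N) ↔ Function.Bijective (cupDualOf X₂ N) := by
  have hpush := e.push_transportMu_bijective N
  have hsq := e.cupDualOf_comp_push N
  constructor
  · intro h
    have h2 : Function.Bijective ((cupDualOf X₂ N) ∘ ((e.transportMu N).push 1).hom) := by
      rw [hsq]; exact (e.dualTransport_bijective N).comp h
    exact (Function.Bijective.of_comp_iff (cupDualOf X₂ N) hpush).mp h2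
  · intro h
    have h2 : Function.Bijective ((e.dualTransport N) ∘ (cupDualOf X₁ N)) := by
      rw [← hsq]; exact h.comp hpush
    exact (Function.Bijective.of_comp_iff' (e.dualTransport_bijective N) (cupDualOf X₁ N)).mp h2

/-! ### Transport of the bijectivity of `θ` -/

/-- `isoHA^ab ⊗ isoFN : H_{A₁}^ab ⊗ F_N(A₁) → H_{A₂}^ab ⊗ F_N(A₂)` (`Thm24Data.recTargetMap` of the
induced data) agrees with `TensorProduct.congr abEquiv isoFN` — hence is bijective.
[cite: MochizukiFrdII2008, Thm 2.4 (i) p.19] -/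
theorem recTargetMap_eq_congr (t : RecTargetOf X₁ N) :
    (e.thm24Data N).recTargetMap t =
      TensorProduct.congr (e.abEquiv.toIntLinearEquiv) ((e.isoFN N).toIntLinearEquiv) t := by
  induction t using TensorProduct.induction_on with
  | zero => rw [map_zero, map_zero]
  | tmul a f =>
    rw [Thm24Data.recTargetMap, TensorProduct.map_tmul, TensorProduct.congr_tmul]
    rfl
  | add x y hx hy => rw [map_add, map_add, hx, hy]

/-- `isoHA^ab ⊗ isoFN` is bijective. [cite: MochizukiFrdII2008, Thm 2.4 (i) p.19] -/
theorem recTargetMap_bijective : Function.Bijective (e.thm24Data N).recTargetMap := by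
  have h : ⇑(e.thm24Data N).recTargetMap =
      ⇑(TensorProduct.congr (e.abEquiv.toIntLinearEquiv) ((e.isoFN N).toIntLinearEquiv)) :=
    funext fun t => e.recTargetMap_eq_congr N t
  rw [h]
  exact (TensorProduct.congr _ _).bijective

/-- `θ₂ ∘ (isoHA^ab ⊗ isoFN) = dualTransport ∘ θ₁` as functions (`thetaHom_recTargetMap`).
[cite: MochizukiFrdII2008, Thm 2.4 (i) p.19] -/
theorem thetaHomOf_comp_recTargetMap :
    (thetaHomOf X₂ N) ∘ (e.thm24Data N).recTargetMap = (e.dualTransport N) ∘ (thetaHomOf X₁ N) :=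
  funext fun t => e.thetaHom_recTargetMap N t

include e in
/-- **`θ` of `X₂` is bijective iff `θ` of `X₁` is**, along any context isomorphism.
[cite: MochizukiFrdII2008, Thm 2.4 (i) p.19] -/
theorem thetaHomOf_bijective_iff :
    Function.Bijective (thetaHomOf X₁ N) ↔ Function.Bijective (thetaHomOf X₂ N) := by
  have hrec := e.recTargetMap_bijective N
  have hsq := e.thetaHomOf_comp_recTargetMap N
  constructor
  · intro h
    have h2 : Function.Bijective ((thetaHomOf X₂ N) ∘ (e.thm24Data N).recTargetMap) := by
      rw [hsq]; exact (e.dualTransport_bijective N).comp h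
    exact (Function.Bijective.of_comp_iff (thetaHomOf X₂ N) hrec).mp h2
  · intro h
    have h2 : Function.Bijective ((e.dualTransport N) ∘ (thetaHomOf X₁ N)) := by
      rw [← hsq]; exact h.comp hrec
    exact (Function.Bijective.of_comp_iff' (e.dualTransport_bijective N) (thetaHomOf X₁ N)).mp h2

/-! ### Consequences -/

include e in
/-- **The duality isomorphism of `X₂` from the bijectivity inputs of an isomorphic `X₁`.**
[cite: MochizukiFrdII2008, Thm 2.4 (i) p.19] -/
def dualityIsoOfBijective' (hθ₁ : Function.Bijective (thetaHomOf X₁ N))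
    (hcup₁ : Function.Bijective (cupDualOf X₁ N)) : DualityIsoOf X₂ N :=
  dualityIsoOfBijective X₂ N ((e.thetaHomOf_bijective_iff N).mp hθ₁) ((e.cupDualOf_bijective_iff N).mp hcup₁)

/-- "(γ₁)" for `dualityIsoOfBijective X₁ …` and the transported `dualityIsoOfBijective' e …`.
[cite: MochizukiFrdII2008, Thm 2.4 (i) p.19] -/
theorem recTargetMap_dualityIsoOfBijective' (hθ₁ : Function.Bijective (thetaHomOf X₁ N))
    (hcup₁ : Function.Bijective (cupDualOf X₁ N))
    (c : groupCohomology.H1 (Rep.ofMulDistribMulAction X₁.HA (Mu N X₁.O))) :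
    (e.thm24Data N).recTargetMap (dualityApply X₁ N (dualityIsoOfBijective X₁ N hθ₁ hcup₁) c) =
      dualityApply X₂ N (e.dualityIsoOfBijective' N hθ₁ hcup₁) (e.isoH1 N c) :=
  e.recTargetMap_dualityIsoOfBijective N hθ₁ hcup₁ _ _ c

end Iso

/-! ### At the arithmetic binding: every context isomorphic to `ofLocalField` of a saturated object -/

section LocalField

open Field IntermediateField
open Literature.NumberTheory.GaloisRepresentations

variable {K : Type} [Field K] [ValuativeRel K] [TopologicalSpace K] [IsNonarchimedeanLocalField K]
  [CharZero K] (L : IntermediateField K (AlgebraicClosure K)) [Normal K L] [FiniteDimensional K L]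
  (H : Subgroup (absoluteGaloisGroup K)) [H.Normal] (hH : IsOpen (H : Set (absoluteGaloisGroup K)))
  (S : StableSubmonoid L) (N : ℕ) [NeZero N]

/-- **The duality isomorphism of ANY Definition 2.2 context isomorphic to the arithmetic context of an
`(N, H)`-saturated object, NO residual input** (both bijectivity inputs transported from
`ofLocalField L H hH S`). [cite: MochizukiFrdII2008, Def 2.2 (ii) p.18] -/
def dualityIsoOfIsoLocalField {X : Def22Context} (e : (ofLocalField L H hH S).Iso X)
    (hS : ∀ x : L, x ^ N = 1 → x ∈ S.toSubmonoid) (h : IsNHSaturated (ofLocalField L H hH S) N) :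
    DualityIsoOf X N :=
  e.dualityIsoOfBijective' N (thetaHom_bijective_ofLocalField L H hH S N hS h)
    (cupDual_bijective_ofLocalField L H hH S N hS h)

/-- **"independent of the choice of `H ↠ H_A` among its `G`-conjugates" at the arithmetic binding, NO
residual input**: for every `g ∈ G_K`, the cup-product isomorphisms of `ofLocalField L H hH S` and of
its conjugate context `(ofLocalField L H hH S).conjOuter g` — the latter EXISTS by transport —
correspond under the canonical identifications (discharging the two inputs of
`recTargetMap_dualityIsoOfLocalField_toConjOuter`). [cite: MochizukiFrdII2008, Def 2.2 (ii) p.18] -/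
theorem recTargetMap_dualityIsoOfLocalField_toConjOuter' (g : absoluteGaloisGroup K)
    (hS : ∀ x : L, x ^ N = 1 → x ∈ S.toSubmonoid) (h : IsNHSaturated (ofLocalField L H hH S) N)
    (c : groupCohomology.H1 (Rep.ofMulDistribMulAction (ofLocalField L H hH S).HA
      (Mu N (ofLocalField L H hH S).O))) :
    ((Iso.toConjOuter (ofLocalField L H hH S) g (resGal L g) rfl).thm24Data N).recTargetMap
        (dualityApply _ N (dualityIsoOfLocalField L H hH S N hS h) c) =
      dualityApply _ N
        (dualityIsoOfIsoLocalField L H hH S N (Iso.toConjOuter (ofLocalField L H hH S) g (resGal L g) rfl)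
          hS h)
        ((Iso.toConjOuter (ofLocalField L H hH S) g (resGal L g) rfl).isoH1 N c) :=
  recTargetMap_dualityIsoOfLocalField_toConjOuter L H hH S N g hS h
    (((Iso.toConjOuter (ofLocalField L H hH S) g (resGal L g) rfl).thetaHomOf_bijective_iff N).mp
      (thetaHom_bijective_ofLocalField L H hH S N hS h))
    (((Iso.toConjOuter (ofLocalField L H hH S) g (resGal L g) rfl).cupDualOf_bijective_iff N).mp
      (cupDual_bijective_ofLocalField L H hH S N hS h)) c

end LocalField

end Def22Context

end PadicKummer

end Literature.AlgebraicGeometry.Frobenioids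

end
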